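import Summits.QuantumFields.GaugeBoot.TorusKSCochainsLoops
import HarnessLib

/-!
# The finite-volume `ℤ₂` centre symmetry of the torus Wilson measure: closed `{1, z}`-cochain twists
# preserve `μ_β`; loops with odd winding (Polyakov lines) have zero expectation; only even tori carry
# Kogut–Susskind staggerings (gauge-boot, L3 structural supplement; `ℤ^d` twist 15)

HONEST FRAMING (cell `pub-gaugeboot`, page 1 of every file): the venture produces certified bounds
on lattice expectations at stated coupling, gauge group, dimension and torus size; NOT a mass gap,
NOT a continuum limit, NOT a string tension; NOT Yang–Mills-summit-bearing (barriers
`FixedCouplingUltralocality`, `PerturbativeInvisibility`). This module bounds no expectation beyond the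
exact value `0` of symmetry-odd observables; no certificate of the cell is involved. Structural.

Twists 13–14 (`TorusKSCochains`, `TorusKSCochainsLoops`): the Kogut–Susskind staggerings of the torus
fall into `2^d` gauge classes; two of them differ by the twist by a CLOSED `{1, z}`-cochain `b`
(plaquette sums `0`), which multiplies a loop with winding `v` by `z^{∑_m v_m hol_m(b)}`. Such a twist
does not change any plaquette (`IsClosed.isStaggering_one`: it is a "staggering with value `1`"), so
it preserves the Wilson action and the Wilson measure — it is the finite-volume CENTRE SYMMETRY
(for the subgroup `{1, z}` of the centre):

* `IsTorusKSCochain.even`, `exists_isTorusKSCochain_iff_even` — **a torus `(ℤ/L)^d` with `d ≥ 2` carries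
  a Kogut–Susskind cochain iff `L` is even** (sum the sign rule over all sites: `L^d ≡ 0 (mod 2)`);
* `IsStaggering.wilsonAction_centralTwist_one`, ★ `IsStaggering.integral_comp_centralTwist_gibbs_one` —
  for ANY periodic lattice `(A, e)`: a central involutive twist with plaquette products `1` preserves
  `μ_β` (`∫ F(T U) dμ_β = ∫ F dμ_β`, every `F`, every real `β`);
* ★★ `IsClosed.integral_comp_centralTwist_wilsonMeasure` — on the torus `(ℤ/L)^d`, `L ≥ 1`: every
  closed `{1,z}`-cochain twist preserves `wilsonMeasure ρ β` (this includes the `{1,z}`-valued gauge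
  transformations `b = td₀ φ` and the coordinate sheets);
* `IsTorusKSCochain.integral_comp_centralTwist_eq` — all KS staggerings compute the SAME `-β`
  expectations (each maps `μ_β` to `μ_{-β}`), consistently with the class dependence of twist 14;
* ★★★ `wilsonExpectation_character_walkHolonomy_eq_zero_of_odd_winding` — **a loop observable
  `χ_ρ(hol_w ∘ lift)` of a `ℤ^d` walk `w : x ⟶ x + L v` with ODD winding `v_m` in some direction has
  expectation `0` at every `β`** (`ρ z = -1`: the sheet twist in direction `m` is a symmetry of `μ_β` and
  flips its sign); in particular ★★★ `wilsonExpectation_polyakovLine_eq_zero` — **every Polyakov line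
  `⟨χ_ρ(P_m(x))⟩_{L,β} = 0`**, every `d, L ≥ 1, β, m, x` (unbroken centre symmetry in finite volume;
  `SU(2n)` / `U(N)`: `…_suEven`, `…_uN`); ★★★ `wilsonExpectation_prod_polyakovLines_eq_zero_of_odd` —
  the `ℤ₂` selection rule: a product of Polyakov lines with an odd number of lines in some direction
  has zero expectation (`IsClosed.wilsonExpectation_eq_zero_of_odd` for any sign-odd observable).

What is NOT claimed: nothing about infinite volume / temperature (deconfinement is a statement about
correlators or the thermodynamic limit, untouched here); nothing for groups whose centre has no
involution with `ρ z = -1` (`SU(2n+1)`: the relevant centre symmetry is `ℤ_N`-valued, not treated).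
[folklore] bookkeeping (A. M. Polyakov, Phys. Lett. B 72 (1978) 477; L. Susskind, Phys. Rev. D 20
(1979) 2610; G. 't Hooft, Nucl. Phys. B 153 (1979) 141; B. Svetitsky, L. Yaffe, Nucl. Phys. B 210
(1982) 423).
-/

noncomputable section

open MeasureTheory SimpleGraph
open Literature.Probability.LatticeModels (Site TorusSite zdGraph Torus.proj)
open Literature.MathematicalPhysics.QuantumFieldTheory (GaugeConfig wilsonMeasure wilsonExpectation)
open Literature.MathematicalPhysics.QuantumLattice

namespace Summit.QuantumFields.GaugeBoot

namespace TiltedRP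

open TorusPoincare

/-! ## Only even tori carry Kogut–Susskind staggerings -/

section Even

variable {d L : ℕ}

/-- **A torus carrying a KS cochain has even side** (as soon as `d ≥ 2`, i.e. two distinct directions
exist): summing the sign rule over all sites, each link term appears twice, so `L^d · 1 = 0` in `ℤ/2`. -/
theorem IsTorusKSCochain.even [NeZero L] {c : TorusSite d L → Fin d → ZMod 2} (hc : IsTorusKSCochain c)
    {k l : Fin d} (hkl : k ≠ l) : Even L := by
  classical
  have hsum : ∑ y : TorusSite d L,
      (c y k + c (y + Pi.single k 1) l + c (y + Pi.single l 1) k + c y l) =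
        ∑ _y : TorusSite d L, (1 : ZMod 2) :=
    Finset.sum_congr rfl fun y _ => hc y k l hkl
  have hk : ∑ y : TorusSite d L, c (y + Pi.single l 1) k = ∑ y : TorusSite d L, c y k :=
    Fintype.sum_equiv (Equiv.addRight (Pi.single l 1)) _ _ fun y => rfl
  have hl : ∑ y : TorusSite d L, c (y + Pi.single k 1) l = ∑ y : TorusSite d L, c y l :=
    Fintype.sum_equiv (Equiv.addRight (Pi.single k 1)) _ _ fun y => rfl
  simp only [Finset.sum_add_distrib, hk, hl, Finset.sum_const, Finset.card_univ, nsmul_eq_mul,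
    mul_one] at hsum
  have h2 : ∀ a b : ZMod 2, a + b + a + b = 0 := by decide
  rw [h2, Fintype.card_pi, Finset.prod_const, ZMod.card, Finset.card_univ, Fintype.card_fin] at hsum
  have h0 : ((L ^ d : ℕ) : ZMod 2) = 0 := by exact_mod_cast hsum.symm
  rw [ZMod.natCast_eq_zero_iff] at h0
  exact even_iff_two_dvd.2 (Nat.Prime.dvd_of_dvd_pow Nat.prime_two h0)

/-- ★ **A torus `(ℤ/L)^d` with `d ≥ 2` and `L ≥ 1` carries a Kogut–Susskind `ℤ/2`-cochain iff `L` is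
even** (the parity cochain for even `L`; the counting argument for odd `L`). -/
theorem exists_isTorusKSCochain_iff_even [NeZero L] (hd : 2 ≤ d) :
    (∃ c : TorusSite d L → Fin d → ZMod 2, IsTorusKSCochain c) ↔ Even L := by
  constructor
  · rintro ⟨c, hc⟩
    exact hc.even (k := ⟨0, by omega⟩) (l := ⟨1, by omega⟩) (by simp [Fin.ext_iff])
  · intro hL
    exact ⟨_, isTorusKSCochain_stagParity (even_iff_two_dvd.1 hL) ⟨0, by omega⟩⟩

end Even

/-! ## Flat central twists preserve the Wilson measure of any periodic lattice -/

section Flat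

variable {A : Type*} [AddCommGroup A] {d N : ℕ} {G : Type*} [Group G]
variable {e : Fin d → A} {s : Link A d → G} (ρ : G →* Matrix (Fin N) (Fin N) ℂ)

/-- A staggering with value `1` (central involutive weights with plaquette products `1`) does not
change any plaquette holonomy. -/
theorem IsStaggering.holonomy_centralTwist_one (hs : IsStaggering e (1 : G) s) (U : Config A d G)
    (x : A) {k l : Fin d} (hkl : k ≠ l) :
    holonomy e (centralTwist s U) x k l = holonomy e U x k l := by
  rw [hs.holonomy_centralTwist U x hkl, one_mul]

/-- … nor any plaquette observable. -/
theorem IsStaggering.plaqObs_centralTwist_one (hs : IsStaggering e (1 : G) s) (p : Plaq A d)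
    (U : Config A d G) : plaqObs ρ e p (centralTwist s U) = plaqObs ρ e p U := by
  unfold plaqObs
  rw [hs.holonomy_centralTwist_one U p.1 (ne_of_lt p.2.2)]

/-- **A flat central twist preserves the Wilson action.** -/
theorem IsStaggering.wilsonAction_centralTwist_one [Fintype A] (hs : IsStaggering e (1 : G) s)
    (U : Config A d G) : wilsonAction ρ e (centralTwist s U) = wilsonAction ρ e U := by
  unfold wilsonAction
  simp_rw [hs.plaqObs_centralTwist_one ρ]

variable [Fintype A] [TopologicalSpace G] [IsTopologicalGroup G] [CompactSpace G] [MeasurableSpace G]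
  [BorelSpace G]

/-- ★ **A flat central twist preserves the Wilson measure** of the periodic lattice:
`∫ F(T_s U) dμ_β(U) = ∫ F dμ_β` for EVERY `F` and every real `β` (the twist preserves the product Haar
measure and the action). -/
theorem IsStaggering.integral_comp_centralTwist_gibbs_one (hs : IsStaggering e (1 : G) s) (β : ℝ)
    {V : Type*} [NormedAddCommGroup V] [NormedSpace ℝ V] (F : Config A d G → V) :
    ∫ U, F (centralTwist s U) ∂(gibbs ρ e β) = ∫ U, F U ∂(gibbs ρ e β) := by
  rw [integral_gibbs, integral_gibbs,
    ← hs.integral_comp_centralTwist_productHaar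
      (fun U => (Real.exp (-β * wilsonAction ρ e U) /
        ∫ U, Real.exp (-β * wilsonAction ρ e U) ∂(productHaar A d G)) • F (centralTwist s U))]
  refine integral_congr_ae (ae_of_all _ fun U => ?_)
  simp only [hs.centralTwist_centralTwist, hs.wilsonAction_centralTwist_one ρ]

end Flat

/-! ## Closed cochain twists of the torus: the centre symmetry -/

section Torus

variable {d L N : ℕ} {G : Type*} [Group G] {z : G}

/-- **A closed `{1,z}`-cochain of the torus is a flat central twist** (plaquette products
`z^{b₁ + b₂ + b₃ + b₄} = z^0 = 1`). -/
theorem _root_.Summit.QuantumFields.GaugeBoot.TorusPoincare.IsClosed.isStaggering_one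
    {b : TorusSite d L → Fin d → ZMod 2} (hb : IsClosed b) (hzc : ∀ g : G, z * g = g * z)
    (hz2 : z * z = 1) : IsStaggering (cubicUnit d L) (1 : G) (cochainTwist z b) where
  comm l g := zpow₂_comm hzc _ g
  mul_self l := zpow₂_mul_self hz2 _
  plaq x k l _ := by
    simp only [cochainTwist_apply, cubicUnit]
    rw [← zpow₂_add hz2, ← zpow₂_add hz2, ← zpow₂_add hz2]
    have h := hb x k l
    have key : ∀ a b' c e : ZMod 2, a + b' - c - e = 0 → a + b' + c + e = 0 := by decide
    rw [key _ _ _ _ h]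
    simp [zpow₂]

variable {G : Type} [Group G] [TopologicalSpace G] [IsTopologicalGroup G] [CompactSpace G]
  [MeasurableSpace G] [BorelSpace G] [SecondCountableTopology G] {z : G}
variable (ρ : G →* Matrix (Fin N) (Fin N) ℂ)

/-- ★★ **Centre symmetry of the torus Wilson measure**: the twist by every CLOSED `{1,z}`-cochain `b` of
`(ℤ/L)^d` (`z` a central involution) preserves `wilsonMeasure ρ β`: `∫ F(T_b U) dμ_β = ∫ F dμ_β` for every
`F`, every real `β`, every `L ≥ 1` (continuous `ρ`; no condition relating `ρ` and `z`). -/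
theorem _root_.Summit.QuantumFields.GaugeBoot.TorusPoincare.IsClosed.integral_comp_centralTwist_wilsonMeasure
    [NeZero L] {b : TorusSite d L → Fin d → ZMod 2} (hb : IsClosed b) (hρ : Continuous ρ)
    (hzc : ∀ g : G, z * g = g * z) (hz2 : z * z = 1) (β : ℝ) {V : Type*} [NormedAddCommGroup V]
    [NormedSpace ℝ V] (F : GaugeConfig d L G → V) :
    ∫ U, F (centralTwist (cochainTwist z b) U) ∂(wilsonMeasure (d := d) (L := L) ρ β) =
      ∫ U, F U ∂(wilsonMeasure (d := d) (L := L) ρ β) := by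
  rw [← gibbs_cubicUnit_eq_wilsonMeasure ρ hρ β]
  exact (hb.isStaggering_one hzc hz2).integral_comp_centralTwist_gibbs_one ρ β F

/-- **All Kogut–Susskind staggerings of the torus compute the same `-β` expectations**: for KS
cochains `c₁, c₂` (any classes) and every `F`, `∫ F(T₁ U) dμ_β = ∫ F(T₂ U) dμ_β` (`= ∫ F dμ_{-β}`,
`ρ z = -1`). -/
theorem IsTorusKSCochain.integral_comp_centralTwist_eq [NeZero L] {c₁ c₂ : TorusSite d L → Fin d → ZMod 2}
    (h₁ : IsTorusKSCochain c₁) (h₂ : IsTorusKSCochain c₂) (hρ : Continuous ρ)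
    (hzc : ∀ g : G, z * g = g * z) (hz2 : z * z = 1) (hρz : ρ z = -1) (β : ℝ) {V : Type*}
    [NormedAddCommGroup V] [NormedSpace ℝ V] (F : GaugeConfig d L G → V) :
    ∫ U, F (centralTwist (cochainTwist z c₁) U) ∂(wilsonMeasure (d := d) (L := L) ρ β) =
      ∫ U, F (centralTwist (cochainTwist z c₂) U) ∂(wilsonMeasure (d := d) (L := L) ρ β) := by
  rw [← gibbs_cubicUnit_eq_wilsonMeasure ρ hρ β,
    (h₁.isStaggering hzc hz2).integral_comp_centralTwist_gibbs ρ hρz β F,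
    (h₂.isStaggering hzc hz2).integral_comp_centralTwist_gibbs ρ hρz β F]

/-! ## Loops with odd winding have zero expectation -/

omit [TopologicalSpace G] [IsTopologicalGroup G] [CompactSpace G] [MeasurableSpace G] [BorelSpace G]
  [SecondCountableTopology G] in
/-- **A closed cochain twist multiplies the character of a loop with winding `v` by
`(-1)^{∑_m v_m hol_m(b)}`** (`ρ z = -1`). -/
theorem character_walkHolonomy_torusLift_centralTwist_of_isClosed {b : TorusSite d L → Fin d → ZMod 2}
    (hb : IsClosed b) (hzc : ∀ g : G, z * g = g * z) (hz2 : z * z = 1) (hρz : ρ z = -1)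
    (U : GaugeConfig d L G) {x y : Site d} (w : (zdGraph d).Walk x y) (v : Site d)
    (hy : y = x + (L : ℤ) • v) :
    normalisedCharacter N (ρ (walkHolonomy (torusLift L (centralTwist (cochainTwist z b) U)) w)) =
      (-1 : ℝ) ^ (∑ m, (v m : ZMod 2) * cycleHolonomy b m).val *
        normalisedCharacter N (ρ (walkHolonomy (torusLift L U) w)) := by
  simp only [normalisedCharacter]
  rw [torusLift_centralTwist_cochainTwist,
    walkHolonomy_centralTwist (s := zpow₂ z ∘ pullCochain L b) (fun l g => zpow₂_comm hzc _ g)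
      (fun l => zpow₂_mul_self hz2 _),
    walkSign_pull_of_isClosed hz2 hb w v hy, map_mul, rep_zpow₂ ρ hρz, smul_mul_assoc, one_mul,
    Matrix.trace_smul, Complex.smul_re, smul_eq_mul]
  ring

/-- ★★★ **Loops with odd winding have zero expectation** (finite-volume centre symmetry): for a
`ℤ^d` walk `w : x ⟶ x + L v` whose winding number `v_m` in some direction `m` is ODD, the loop
observable `χ_ρ(hol_w ∘ lift)` has `⟨·⟩_{L,β} = 0` at every real `β` (`ρ` continuous, `ρ z = -1`,
`L ≥ 1`): the sheet twist in direction `m` preserves `μ_β` and reverses its sign. -/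
theorem wilsonExpectation_character_walkHolonomy_eq_zero_of_odd_winding [NeZero L]
    (hρ : Continuous ρ) (hzc : ∀ g : G, z * g = g * z) (hz2 : z * z = 1) (hρz : ρ z = -1) (β : ℝ)
    {x y : Site d} (w : (zdGraph d).Walk x y) (v : Site d) (hy : y = x + (L : ℤ) • v) {m : Fin d}
    (hm : Odd (v m)) :
    wilsonExpectation (L := L) ρ β
      (fun U => normalisedCharacter N (ρ (walkHolonomy (torusLift L U) w))) = 0 := by
  set f : GaugeConfig d L G → ℝ := fun U => normalisedCharacter N (ρ (walkHolonomy (torusLift L U) w))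
  have hb : IsClosed (sheet (L := L) m (1 : ZMod 2)) := isClosed_sheet m 1
  -- the sheet twist flips the sign of `f`
  have hflip : ∀ U, f (centralTwist (cochainTwist z (sheet m 1)) U) = -f U := by
    intro U
    simp only [f]
    rw [character_walkHolonomy_torusLift_centralTwist_of_isClosed ρ hb hzc hz2 hρz U w v hy]
    have hsum : ∑ m', (v m' : ZMod 2) * cycleHolonomy (sheet (L := L) m (1 : ZMod 2)) m' = 1 := by
      rw [Finset.sum_eq_single m]
      · rw [cycleHolonomy_sheet, if_pos rfl, mul_one, (ZMod.intCast_eq_one_iff_odd).2 hm]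
      · intro m' _ hm'; rw [cycleHolonomy_sheet, if_neg hm', mul_zero]
      · intro h; exact absurd (Finset.mem_univ m) h
    rw [hsum, ZMod.val_one, pow_one, neg_one_mul]
  -- and preserves the measure
  have h := hb.integral_comp_centralTwist_wilsonMeasure ρ hρ hzc hz2 β f
  simp only [hflip, integral_neg] at h
  unfold wilsonExpectation
  linarith

/-- ★★★ **Every Polyakov line has zero expectation on the torus** (unbroken centre symmetry in
finite volume): `⟨χ_ρ(P_m(x))⟩_{(ℤ/L)^d, β} = 0` for the straight walk of `L` steps in direction `m`
from any `x`, every `d`, every `L ≥ 1`, every real `β` (`ρ` continuous with `ρ z = -1`). -/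
theorem wilsonExpectation_polyakovLine_eq_zero [NeZero L] (hρ : Continuous ρ)
    (hzc : ∀ g : G, z * g = g * z) (hz2 : z * z = 1) (hρz : ρ z = -1) (β : ℝ) (m : Fin d)
    (x : Site d) :
    wilsonExpectation (L := L) ρ β
      (fun U => normalisedCharacter N (ρ (walkHolonomy (torusLift L U) (lineWalk m L x)))) = 0 :=
  wilsonExpectation_character_walkHolonomy_eq_zero_of_odd_winding ρ hρ hzc hz2 hρz β (lineWalk m L x)
    (Pi.single m 1) (by rw [single_natCast_eq_zsmul]) (by rw [Pi.single_eq_same]; exact odd_one)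

end Torus

/-! ## The cell's gauge groups -/

section Groups

open Literature.MathematicalPhysics.QuantumLattice (fundamentalRep unitaryFundamentalRep
  continuous_fundamentalRep continuous_unitaryFundamentalRep)

variable {d L : ℕ} [NeZero L]

/-- ★★ **`SU(M)`, `M` even (so `SU(2)`): every fundamental Polyakov line has zero expectation** on every
torus `(ℤ/L)^d`, every real `β`. -/
theorem wilsonExpectation_polyakovLine_eq_zero_suEven {M : ℕ} (hM : Even M) (β : ℝ) (m : Fin d)
    (x : Site d) :
    wilsonExpectation (L := L) (fundamentalRep (Fin M)) β
      (fun U => normalisedCharacter M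
        (fundamentalRep (Fin M) (walkHolonomy (torusLift L U) (lineWalk m L x)))) = 0 :=
  wilsonExpectation_polyakovLine_eq_zero (fundamentalRep (Fin M))
    (z := ⟨-1, neg_one_mem_specialUnitaryGroup_of_even hM⟩) (continuous_fundamentalRep (Fin M))
    (fun g => Subtype.ext (by simp)) (Subtype.ext (by simp)) (by rw [fundamentalRep_apply]) β m x

/-- ★★ **`U(N)`: every fundamental Polyakov line has zero expectation** on every torus, every `β`. -/
theorem wilsonExpectation_polyakovLine_eq_zero_uN {N : ℕ} (β : ℝ) (m : Fin d) (x : Site d) :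
    wilsonExpectation (L := L) (unitaryFundamentalRep (Fin N) ℂ) β
      (fun U => normalisedCharacter N
        (unitaryFundamentalRep (Fin N) ℂ (walkHolonomy (torusLift L U) (lineWalk m L x)))) = 0 :=
  wilsonExpectation_polyakovLine_eq_zero (unitaryFundamentalRep (Fin N) ℂ)
    (z := ⟨-1, by simp [Matrix.mem_unitaryGroup_iff]⟩) (continuous_unitaryFundamentalRep (Fin N) ℂ)
    (fun g => Subtype.ext (by simp)) (Subtype.ext (by simp)) rfl β m x

end Groups

/-! ## The `ℤ₂` selection rule for products of Polyakov lines -/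

section Selection

variable {d L N : ℕ} {G : Type} [Group G] [TopologicalSpace G] [IsTopologicalGroup G] [CompactSpace G]
  [MeasurableSpace G] [BorelSpace G] [SecondCountableTopology G] {z : G}
variable (ρ : G →* Matrix (Fin N) (Fin N) ℂ)

/-- **An observable that changes sign under a closed `{1,z}`-cochain twist has zero expectation**
(centre symmetry; every real `β`, `L ≥ 1`). -/
theorem _root_.Summit.QuantumFields.GaugeBoot.TorusPoincare.IsClosed.wilsonExpectation_eq_zero_of_odd
    [NeZero L] {b : TorusSite d L → Fin d → ZMod 2} (hb : IsClosed b) (hρ : Continuous ρ)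
    (hzc : ∀ g : G, z * g = g * z) (hz2 : z * z = 1) (β : ℝ) {F : GaugeConfig d L G → ℝ}
    (hF : ∀ U, F (centralTwist (cochainTwist z b) U) = -F U) :
    wilsonExpectation (L := L) ρ β F = 0 := by
  have h := hb.integral_comp_centralTwist_wilsonMeasure ρ hρ hzc hz2 β F
  simp only [hF, integral_neg] at h
  unfold wilsonExpectation
  linarith

omit [TopologicalSpace G] [IsTopologicalGroup G] [CompactSpace G] [MeasurableSpace G] [BorelSpace G]
  [SecondCountableTopology G] in
/-- Under the sheet twist in direction `m` the Polyakov line in direction `μ` is multiplied by `-1` if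
`μ = m` and is unchanged otherwise (`ρ z = -1`). -/
theorem character_polyakovLine_sheetTwist (hzc : ∀ g : G, z * g = g * z) (hz2 : z * z = 1)
    (hρz : ρ z = -1) [NeZero L] (m μ : Fin d) (x : Site d) (U : GaugeConfig d L G) :
    normalisedCharacter N (ρ (walkHolonomy (torusLift L (centralTwist (cochainTwist z
      (sheet (L := L) m (1 : ZMod 2))) U)) (lineWalk μ L x))) =
      (if μ = m then -1 else 1) *
        normalisedCharacter N (ρ (walkHolonomy (torusLift L U) (lineWalk μ L x))) := by
  rw [character_walkHolonomy_torusLift_centralTwist_of_isClosed ρ (isClosed_sheet m 1) hzc hz2 hρz U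
    (lineWalk μ L x) (Pi.single μ 1) (by rw [single_natCast_eq_zsmul])]
  congr 1
  have hsum : ∑ m', ((Pi.single μ (1 : ℤ) : Site d) m' : ZMod 2) * cycleHolonomy (sheet (L := L) m (1 : ZMod 2)) m' =
      if μ = m then 1 else 0 := by
    rw [Finset.sum_eq_single μ]
    · simp [cycleHolonomy_sheet]
    · intro m' _ hm'; simp [Pi.single_eq_of_ne hm']
    · intro h; exact absurd (Finset.mem_univ μ) h
  rw [hsum]
  split_ifs
  · rw [ZMod.val_one, pow_one]
  · rw [ZMod.val_zero, pow_zero]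

/-- ★★★ **The `ℤ₂` selection rule for Polyakov-line correlators**: a product of Polyakov-line
characters `∏_a χ_ρ(P_{μ_a}(x_a))` in which some direction `m` occurs an ODD number of times has zero
expectation on every torus `(ℤ/L)^d`, at every real `β` (`ρ` continuous with `ρ z = -1`; `L ≥ 1`) — e.g.
`⟨P⟩ = ⟨P P' P''⟩ = 0` for parallel lines while `⟨P(x) P(y)⟩` is not constrained. -/
theorem wilsonExpectation_prod_polyakovLines_eq_zero_of_odd [NeZero L] (hρ : Continuous ρ)
    (hzc : ∀ g : G, z * g = g * z) (hz2 : z * z = 1) (hρz : ρ z = -1) (β : ℝ) {n : ℕ}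
    (μ : Fin n → Fin d) (x : Fin n → Site d) {m : Fin d}
    (hodd : Odd (Finset.univ.filter fun a => μ a = m).card) :
    wilsonExpectation (L := L) ρ β
      (fun U => ∏ a, normalisedCharacter N (ρ (walkHolonomy (torusLift L U) (lineWalk (μ a) L (x a))))) = 0 := by
  refine (isClosed_sheet m (1 : ZMod 2)).wilsonExpectation_eq_zero_of_odd ρ hρ hzc hz2 β fun U => ?_
  simp only [character_polyakovLine_sheetTwist ρ hzc hz2 hρz, Finset.prod_mul_distrib]
  rw [Finset.prod_ite, Finset.prod_const, Finset.prod_const_one, mul_one, hodd.neg_one_pow, neg_one_mul]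

/-- ★★ `SU(M)`, `M` even (so `SU(2)`): the `ℤ₂` selection rule for fundamental Polyakov-line correlators. -/
theorem wilsonExpectation_prod_polyakovLines_eq_zero_of_odd_suEven [NeZero L] {M : ℕ} (hM : Even M)
    (β : ℝ) {n : ℕ} (μ : Fin n → Fin d) (x : Fin n → Site d) {m : Fin d}
    (hodd : Odd (Finset.univ.filter fun a => μ a = m).card) :
    wilsonExpectation (L := L) (Literature.MathematicalPhysics.QuantumLattice.fundamentalRep (Fin M)) β
      (fun U => ∏ a, normalisedCharacter M (Literature.MathematicalPhysics.QuantumLattice.fundamentalRep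
        (Fin M) (walkHolonomy (torusLift L U) (lineWalk (μ a) L (x a))))) = 0 :=
  wilsonExpectation_prod_polyakovLines_eq_zero_of_odd (Literature.MathematicalPhysics.QuantumLattice.fundamentalRep (Fin M))
    (z := ⟨-1, neg_one_mem_specialUnitaryGroup_of_even hM⟩)
    (Literature.MathematicalPhysics.QuantumLattice.continuous_fundamentalRep (Fin M))
    (fun g => Subtype.ext (by simp)) (Subtype.ext (by simp))
    (by rw [Literature.MathematicalPhysics.QuantumLattice.fundamentalRep_apply]) β μ x hodd

end Selection

end TiltedRP

end Summit.QuantumFields.GaugeBoot
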